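import Summits.QuantumAdvantage.AdviceFreeQNC0.DiversityRungs
import Mathlib.Algebra.BigOperators.Fin
import HarnessLib

/-!
# Cell qa-qnc0 (rung F-Q1, density axis, crux of record `TensorMultOneAt`): a GENERIC kernel checker
# for PACKING CERTIFICATES of `DiversityPays` (planner qa-qnc0-p1 Sketch13 v4, ROUND-12 §2.10(vi))

`DiversityPays m s blocks V` (Sketch13 v4, `DiversityRungs.lean`): in every additive group of exponent
`2` with a subadditive nonnegative weight `nrm`, a last player measurable w.r.t. `blocks` pays
`V·nrm e ≤ Σ_u nrm (lastPlayerVal u)`.  The value of the last player at `u ∈ {0,1}^m` depends only on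
the TYPE `(|u| mod 3, block-parity pattern of u)`; a multiset `A` of vectors is a VALID COLUMN when
each residue class meets it in an ODD number of vectors and, for every block `j`, the classes `{0,2}`
resp. `{1,2}` contain an EVEN number of vectors of `A` with block-`j` parity `1` — then
`Σ_{u ∈ A} lastPlayerVal u = e` identically (`sum_val_eq_e`), so `nrm e ≤ Σ_{u ∈ A} nrm (lastPlayerVal u)`.
A PACKING CERTIFICATE is a list of (multiplicity `w_A ∈ ℕ`, valid column `A`) with every vector used
at most `d` times in total; it proves `DiversityPays m s blocks ((Σ_A w_A)/d)` — the fractional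
packing number of the planner's `kit13/vs_partition.py` LP, u-resolved.

* `DiversityCert.CertOK blocks d cert` — the decidable certificate predicate (vectors coded by
  `Fin (2^m)`, bit `i` = coordinate `i`, `DiversityCert.dec`);
* **`diversityPays_of_certOK : 0 < d → CertOK blocks d cert → DiversityPays m s blocks ((wsum cert)/d)`**.

Instances (checked by `decide +kernel` on explicit certificates): `TensorLPCertificates.lean`
(full diversity, `m = 4, …, 8`) and `div2222PaysEight` there.  The cell's construction (not in print;
the LP is ROUND-12 §2.10(vi) / Audoux–Couvreur 2019 Thm 1 in the single-block case).

WHAT THIS IS NOT: no certificate beats the LP (F12.4); nothing on MULT₁ proper; separation NOT moved.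
-/

namespace Summit.QuantumAdvantage.AdviceFreeQNC0

open Finset

namespace DiversityCert

variable {m s : ℕ}

/-! ### Codes of vectors, types, valid columns, certificates -/

/-- Decoding `Fin (2^m) ≃ {0,1}^m`: coordinate `i` of the code `c` is bit `i` of `c`. -/
def dec (m : ℕ) : Fin (2 ^ m) ≃ (Fin m → Bool) :=
  finFunctionFinEquiv.symm.trans (Equiv.arrowCongr (Equiv.refl (Fin m)) finTwoEquiv)

/-- Residue class `|u| mod 3` of the coded vector. -/
def cls (m : ℕ) (c : Fin (2 ^ m)) : ℕ := (univ.filter fun i : Fin m => dec m c i = true).card % 3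

/-- Block-`j` parity bit of the coded vector. -/
def pbit (blocks : Fin s → Finset (Fin m)) (c : Fin (2 ^ m)) (j : Fin s) : Bool :=
  blockPar (blocks j) (dec m c)

/-- A VALID COLUMN: every residue class is met an odd number of times, and for every block `j` the
vectors of classes `≠ 1` (resp. `≠ 0`) with block-`j` parity `1` come in even number (so that the
`g₀ j` resp. `g₁ j` contributions cancel in an exponent-`2` group). -/
abbrev ColValid (blocks : Fin s → Finset (Fin m)) (A : List (Fin (2 ^ m))) : Prop :=
  (∀ r < 3, (A.countP fun c => cls m c = r) % 2 = 1) ∧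
  (∀ j : Fin s, (A.countP fun c => cls m c ≠ 1 ∧ pbit blocks c j = true) % 2 = 0) ∧
  (∀ j : Fin s, (A.countP fun c => cls m c ≠ 0 ∧ pbit blocks c j = true) % 2 = 0)

/-- Total multiplicity with which the certificate uses the vector `c`. -/
def load (cert : List (ℕ × List (Fin (2 ^ m)))) (c : Fin (2 ^ m)) : ℕ :=
  (cert.map fun wa => wa.1 * wa.2.count c).sum

/-- Total multiplicity of the certificate (the packing value times the denominator). -/
def wsum (cert : List (ℕ × List (Fin (2 ^ m)))) : ℕ := (cert.map Prod.fst).sum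

/-- A PACKING CERTIFICATE with denominator `d`: all columns valid, every vector loaded `≤ d`. -/
abbrev CertOK (blocks : Fin s → Finset (Fin m)) (d : ℕ) (cert : List (ℕ × List (Fin (2 ^ m)))) : Prop :=
  (∀ wa ∈ cert, ColValid blocks wa.2) ∧ ∀ c : Fin (2 ^ m), load cert c ≤ d

/-- Action of a coordinate map `σ : Fin m → Fin m` on codes: coordinate `i` of `permCode σ c` is
coordinate `σ i` of `c` (used to write SYMMETRISED certificates compactly). -/
def permCode (σ : Fin m → Fin m) (c : Fin (2 ^ m)) : Fin (2 ^ m) := (dec m).symm fun i => dec m c (σ i)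

/-- Expansion of base columns under a list of coordinate maps: the symmetrised certificate
`{(w, σ·A) : (w, A) ∈ base, σ ∈ H}` (the checker re-verifies every expanded column, so no group
structure on `H` is assumed). -/
def expand (H : List (Fin m → Fin m)) (base : List (ℕ × List (Fin (2 ^ m)))) :
    List (ℕ × List (Fin (2 ^ m))) :=
  base.flatMap fun wa => H.map fun σ => (wa.1, wa.2.map (permCode σ))

/-! ### The last player's value as a function of the type -/

section Value

variable {Q : Type} [AddCommGroup Q] (blocks : Fin s → Finset (Fin m)) (c₀ c₁ e : Q) (g₀ g₁ : Fin s → Q)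

/-- The last player's value at the coded vector, in "indicator form". -/
theorem val_dec (c : Fin (2 ^ m)) :
    lastPlayerVal blocks c₀ c₁ e g₀ g₁ (dec m c) =
      (if cls m c = 0 ∨ cls m c = 2 then c₀ else 0) + (if cls m c = 1 ∨ cls m c = 2 then c₁ else 0) +
      (if cls m c = 2 then e else 0) +
      ∑ j : Fin s, (if cls m c ≠ 1 ∧ pbit blocks c j = true then g₀ j else 0) +
      ∑ j : Fin s, (if cls m c ≠ 0 ∧ pbit blocks c j = true then g₁ j else 0) := by
  have h3 : cls m c < 3 := Nat.mod_lt _ (by norm_num)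
  simp only [lastPlayerVal]
  change (if cls m c = 0 then _ else if cls m c = 1 then _ else _) = _
  rcases (by omega : cls m c = 0 ∨ cls m c = 1 ∨ cls m c = 2) with h | h | h <;>
    simp [h, pbit]

/-- Sum of the last player's values over a list of coded vectors, by counts. -/
theorem sum_map_val (A : List (Fin (2 ^ m))) :
    (A.map fun c => lastPlayerVal blocks c₀ c₁ e g₀ g₁ (dec m c)).sum =
      (A.countP fun c => cls m c = 0 ∨ cls m c = 2) • c₀ + (A.countP fun c => cls m c = 1 ∨ cls m c = 2) • c₁ +
      (A.countP fun c => cls m c = 2) • e +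
      ∑ j : Fin s, (A.countP fun c => cls m c ≠ 1 ∧ pbit blocks c j = true) • g₀ j +
      ∑ j : Fin s, (A.countP fun c => cls m c ≠ 0 ∧ pbit blocks c j = true) • g₁ j := by
  induction A with
  | nil => simp
  | cons c A ih =>
    rw [List.map_cons, List.sum_cons, ih, val_dec]
    simp only [List.countP_cons, add_smul, sum_add_distrib, ite_smul, one_smul, zero_smul,
      decide_eq_true_eq]
    abel

/-- Counting a disjunction of the (disjoint) residue classes. -/
theorem countP_or (A : List (Fin (2 ^ m))) {a b : ℕ} (hab : a ≠ b) :
    (A.countP fun c => cls m c = a ∨ cls m c = b) =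
      (A.countP fun c => cls m c = a) + (A.countP fun c => cls m c = b) := by
  induction A with
  | nil => simp
  | cons c A ih =>
    rw [List.countP_cons, List.countP_cons, List.countP_cons, ih]
    by_cases ha : cls m c = a
    · have hb : ¬ cls m c = b := fun h => hab (ha.symm.trans h)
      rw [if_pos (decide_eq_true (Or.inl ha)), if_pos (decide_eq_true ha),
        if_neg (mt of_decide_eq_true hb)]
      omega
    · by_cases hb : cls m c = b
      · rw [if_pos (decide_eq_true (Or.inr hb)), if_neg (mt of_decide_eq_true ha),
          if_pos (decide_eq_true hb)]
        omega
      · rw [if_neg (mt of_decide_eq_true (not_or.2 ⟨ha, hb⟩)), if_neg (mt of_decide_eq_true ha),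
          if_neg (mt of_decide_eq_true hb)]
        omega

/-- In an exponent-2 group, `n • x` only depends on `n mod 2`. -/
theorem nsmul_eq_mod_two (h2 : ∀ x : Q, x + x = 0) (n : ℕ) (x : Q) :
    n • x = if n % 2 = 1 then x else 0 := by
  have h : ∀ q : ℕ, (2 * q) • x = 0 := fun q => by
    induction q with
    | zero => simp
    | succ q ih => rw [Nat.mul_succ, add_nsmul, ih, two_nsmul, h2, add_zero]
  rcases Nat.even_or_odd n with ⟨q, hq⟩ | ⟨q, hq⟩
  · rw [hq, ← two_mul, h, if_neg (by omega)]
  · rw [hq, add_nsmul, h, one_nsmul, zero_add, if_pos (by omega)]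

/-- **A valid column sums to `e`** in every exponent-2 group. -/
theorem sum_val_eq_e (h2 : ∀ x : Q, x + x = 0) {A : List (Fin (2 ^ m))} (hA : ColValid blocks A) :
    (A.map fun c => lastPlayerVal blocks c₀ c₁ e g₀ g₁ (dec m c)).sum = e := by
  obtain ⟨hodd, hev₀, hev₁⟩ := hA
  have h0 := hodd 0 (by norm_num)
  have h1 := hodd 1 (by norm_num)
  have h2' := hodd 2 (by norm_num)
  rw [sum_map_val, countP_or A (by norm_num : (0:ℕ) ≠ 2), countP_or A (by norm_num : (1:ℕ) ≠ 2)]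
  simp only [nsmul_eq_mod_two h2]
  rw [if_neg (by omega), if_neg (by omega), if_pos h2', zero_add, zero_add]
  have hs₀ : ∑ j : Fin s, (if (A.countP fun c => cls m c ≠ 1 ∧ pbit blocks c j = true) % 2 = 1
      then g₀ j else 0) = 0 := sum_eq_zero fun j _ => by rw [if_neg (by rw [hev₀ j]; norm_num)]
  have hs₁ : ∑ j : Fin s, (if (A.countP fun c => cls m c ≠ 0 ∧ pbit blocks c j = true) % 2 = 1
      then g₁ j else 0) = 0 := sum_eq_zero fun j _ => by rw [if_neg (by rw [hev₁ j]; norm_num)]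
  rw [hs₀, hs₁, add_zero, add_zero]

/-- A valid column is nonempty (class `2` is met an odd number of times). -/
theorem ne_nil_of_colValid {A : List (Fin (2 ^ m))} (hA : ColValid blocks A) : A ≠ [] := by
  rintro rfl
  have h := hA.1 2 (by norm_num)
  simp at h

end Value

/-! ### Subadditivity along a list and the regrouping of the certificate -/

/-- Subadditivity of a weight along a nonempty list. -/
theorem nrm_sum_le {Q : Type} [AddCommGroup Q] (nrm : Q → ℝ)
    (hsub : ∀ a b : Q, nrm (a + b) ≤ nrm a + nrm b) :
    ∀ {L : List Q}, L ≠ [] → nrm L.sum ≤ (L.map nrm).sum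
  | [], h => absurd rfl h
  | [a], _ => by simp
  | a :: b :: L, _ => by
    rw [List.sum_cons, List.map_cons, List.sum_cons]
    exact (hsub _ _).trans (add_le_add_right (nrm_sum_le nrm hsub (List.cons_ne_nil b L)) _)

/-- A list sum of `g` regrouped by multiplicities over the finite code type. -/
theorem list_sum_map_eq (A : List (Fin (2 ^ m))) (g : Fin (2 ^ m) → ℝ) :
    (A.map g).sum = ∑ c : Fin (2 ^ m), (A.count c : ℝ) * g c := by
  induction A with
  | nil => simp
  | cons a A ih =>
    rw [List.map_cons, List.sum_cons, ih]
    simp only [List.count_cons, Nat.cast_add, Nat.cast_ite, Nat.cast_one, Nat.cast_zero, add_mul,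
      sum_add_distrib, ite_mul, one_mul, zero_mul, beq_iff_eq, Finset.sum_ite_eq, mem_univ, if_true]
    ring

/-- The certificate's weighted column sums regrouped by vector: `Σ_A w_A Σ_{c∈A} g c = Σ_c load(c)·g c`. -/
theorem cert_sum_eq (cert : List (ℕ × List (Fin (2 ^ m)))) (g : Fin (2 ^ m) → ℝ) :
    (cert.map fun wa => (wa.1 : ℝ) * (wa.2.map g).sum).sum =
      ∑ c : Fin (2 ^ m), (load cert c : ℝ) * g c := by
  induction cert with
  | nil => simp [load]
  | cons wa cert ih =>
    rw [List.map_cons, List.sum_cons, ih, list_sum_map_eq, mul_sum, ← sum_add_distrib]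
    refine sum_congr rfl fun c _ => ?_
    simp only [load, List.map_cons, List.sum_cons, Nat.cast_add, Nat.cast_mul]
    ring

/-! ### The checker theorem -/

/-- **Packing certificates prove `DiversityPays`**: if every column of `cert` is valid and every vector
is used at most `d` times, the last player pays at least `(Σ_A w_A)/d` times `nrm e` in every normed
exponent-2 group. -/
theorem diversityPays_of_certOK {blocks : Fin s → Finset (Fin m)} {d : ℕ}
    {cert : List (ℕ × List (Fin (2 ^ m)))} (hd : 0 < d) (h : CertOK blocks d cert) :
    DiversityPays m s blocks ((wsum cert : ℝ) / d) := by
  intro Q _ nrm hsub hnn h2 c₀ c₁ e g₀ g₁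
  obtain ⟨hvalid, hload⟩ := h
  set φ : Fin (2 ^ m) → Q := fun c => lastPlayerVal blocks c₀ c₁ e g₀ g₁ (dec m c) with hφ
  -- each column pays `nrm e`
  have hcol : ∀ wa ∈ cert, nrm e ≤ (wa.2.map fun c => nrm (φ c)).sum := by
    intro wa hwa
    have hv := hvalid wa hwa
    have hs : (wa.2.map φ).sum = e := sum_val_eq_e blocks c₀ c₁ e g₀ g₁ h2 hv
    have hne : wa.2.map φ ≠ [] := by
      intro h0; exact ne_nil_of_colValid blocks hv (List.map_eq_nil_iff.1 h0)
    have := nrm_sum_le nrm hsub hne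
    rw [hs, List.map_map] at this
    exact this
  -- summing with the multiplicities
  have hlow : ((wsum cert : ℕ) : ℝ) * nrm e ≤
      (cert.map fun wa => (wa.1 : ℝ) * (wa.2.map fun c => nrm (φ c)).sum).sum := by
    have : ∀ L : List (ℕ × List (Fin (2 ^ m))), (∀ wa ∈ L, nrm e ≤ (wa.2.map fun c => nrm (φ c)).sum) →
        (((L.map Prod.fst).sum : ℕ) : ℝ) * nrm e ≤
          (L.map fun wa => (wa.1 : ℝ) * (wa.2.map fun c => nrm (φ c)).sum).sum := by
      intro L hL
      induction L with
      | nil => simp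
      | cons wa L ih =>
        rw [List.map_cons, List.sum_cons, List.map_cons, List.sum_cons, Nat.cast_add, add_mul]
        exact add_le_add (mul_le_mul_of_nonneg_left (hL wa (by simp)) (Nat.cast_nonneg _))
          (ih fun wa' h' => hL wa' (by simp [h']))
    exact this cert hcol
  -- regroup by vector and use the load bound
  have hup : (cert.map fun wa => (wa.1 : ℝ) * (wa.2.map fun c => nrm (φ c)).sum).sum ≤
      (d : ℝ) * ∑ u : Fin m → Bool, nrm (lastPlayerVal blocks c₀ c₁ e g₀ g₁ u) := by
    rw [cert_sum_eq, ← Equiv.sum_comp (dec m), mul_sum]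
    refine sum_le_sum fun c _ => mul_le_mul_of_nonneg_right ?_ (hnn _)
    exact_mod_cast hload c
  have hd' : (0 : ℝ) < d := by exact_mod_cast hd
  rw [div_mul_eq_mul_div, div_le_iff₀ hd', mul_comm _ (d : ℝ)]
  exact hlow.trans hup

/-- Convenience form: any `V` with `V·d = Σ_A w_A` is paid. -/
theorem diversityPays_of_certOK' {blocks : Fin s → Finset (Fin m)} {d : ℕ}
    {cert : List (ℕ × List (Fin (2 ^ m)))} (hd : 0 < d) (h : CertOK blocks d cert) {V : ℝ}
    (hV : V * d = wsum cert) : DiversityPays m s blocks V := by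
  have hd' : (0 : ℝ) < d := by exact_mod_cast hd
  have e : V = (wsum cert : ℝ) / d := by rw [← hV, mul_div_cancel_right₀ V hd'.ne']
  rw [e]
  exact diversityPays_of_certOK hd h

end DiversityCert

end Summit.QuantumAdvantage.AdviceFreeQNC0
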